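import Literature.AnabelianGeometry.EtaleTheta.Discharge.Sec3Cor38iiOfInputs
import Literature.AnabelianGeometry.EtaleTheta.Discharge.Sec3Cor38StdIsoNotGL
import Literature.AnabelianGeometry.EtaleTheta.Discharge.Sec3Thm37Holds

/-!
# [EtTh] Corollary 3.8 (ii) — the knit at the CANONICAL vocabularies (`treeMonoidVocab`, `treeCatVocab`):
# "`C_i` is a Frobenioid" ([FrdI] Thm. 5.2 (ii)) and C38-L01 ([EtTh] Thm. 3.7 (i)(ii)) discharged by name

Mochizuki, *The étale theta function …*, Publ. RIMS **45** (2009), Cor. 3.8 (ii), PDF pp. 80–82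
[cite: MochizukiEtTh2009, Cor 3.8 p.81]. abc-iut cell, layer L2, cone node `EtTh:Cor3.8(ii)`, seat abc-iut-w6-d040;
proof-only sequel (0 definitions) of `Discharge/Sec3Cor38iiOfInputs.lean` (p431051).  There the node's closing
theorem `Cor38Hyp.cor38_ii_of_criterion_tree` keeps the binders `hF_i : PreFrobenioid.IsFrobenioid C_i.toElem`
([FrdI] Thm. 5.2 (ii)) and `H : h.StandardIsotropicNotGroupLike` (row C38-L01: "by Theorem 3.7, (i), (ii), `C₁`,
`C₂` are of standard and isotropic type, but not of group-like type").  At the canonical [FrdI] category vocabulary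
`treeCatVocab D IsRational IsStrictlyRational` (abc-iut-L2-t3, `FrdIVocabulary.lean`) over the tree's monoid
vocabulary `treeMonoidVocab`, both are THEOREMS of the tree modulo the single standing residual
`hBmon_i : IsMonoidOn C_i.ratFnFunctor` ("`𝔹` is a monoid on `D`", [FrdI] Thm. 5.2 preamble):
`TemperedFrobenioid.isFrobenioid_treeCatVocab_of_isMonoidOn` (abc-iut-L2-t3, `Sec3Thm37Holds`, from L1's proved
[FrdI] Thm. 5.2 (ii)) and `Cor38Hyp.standardIsotropicNotGroupLike_treeCatVocab` (abc-iut-w5-d135,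
`Sec3Cor38StdIsoNotGL`, p429066: standard type from Thm. 3.7 (ii) = `h.fsmff` + `h.nonDilating`; isotropic / not
group-like unconditional).  This file substitutes them:

  `Cor38Hyp.cor38_ii_canonical` — [EtTh] Cor. 3.8 (ii) AS TYPED (vocabulary parameter := [FrdI] Def. 4.5 (iv))
  from: `h34` = [FrdI] Thm. 3.4 (ii) (0-ary fact F-0711, PROVED in the tree: `FrdI.Thm34ii_holds`) · `h411` = [FrdI]
  Cor. 4.11 (ii) (0-ary fact F-0715) · `hBmon₁`, `hBmon₂` · [EtTh] Rmk. 3.6.3 `hR₁`, `hR₂` (F-0581) · the criterion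
  C38-L05 at THE perfections, `h5₁`, `h5₂` (producers: `bsFldPreStepLimitCriterion_of` modulo GAP-LEDGER
  G-w5d124-1/2/3, and abc-iut-w4-d084's variants).

HONEST FRAMING: refereed pre-IUT material ([EtTh] §3); nothing here bears on [IUTchIII] Cor. 3.12; no side taken;
typed ≠ proved — here proved modulo the displayed named binders.
-/

namespace Literature.AnabelianGeometry.EtaleTheta

open CategoryTheory Opposite Literature.AlgebraicGeometry.Frobenioids

universe u₀ v₀ u v w

namespace Cor38Hyp

variable {D₀ : Type u₀} [Category.{v₀} D₀] {D₀' : Type u₀} [Category.{v₀} D₀']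
  {T : RealifiedDivisorMonoids (D₀ := D₀) treeMonoidVocab.{w}}
  {T' : RealifiedDivisorMonoids (D₀ := D₀') treeMonoidVocab.{w}}
  {D : Type u} [Category.{v} D] {D' : Type u} [Category.{v} D']
  {IsRational IsStrictlyRational : (Dᵒᵖ ⥤ CommMonCat.{w}) → Prop}
  {IsRational' IsStrictlyRational' : (D'ᵒᵖ ⥤ CommMonCat.{w}) → Prop}
  {C₁ : TemperedFrobenioid T D (treeCatVocab D IsRational IsStrictlyRational)}
  {C₂ : TemperedFrobenioid T' D' (treeCatVocab D' IsRational' IsStrictlyRational')} (h : Cor38Hyp C₁ C₂)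

/-- **[EtTh] Cor. 3.8 (ii) AS TYPED at the canonical vocabularies** (abc-iut-L2-t3's `Cor38_ii`, its vocabulary
parameter `IsDivSlim (E) (Φ)` instantiated by [FrdI] Def. 4.5 (iv) read on `(E, Φ)`), the node `EtTh:Cor3.8(ii)`
closed modulo NAMED inputs only: `h34` ([FrdI] Thm. 3.4 (ii), F-0711, proved in the tree), `h411` ([FrdI] Cor. 4.11
(ii), F-0715), `hBmon_i` ("`𝔹_i` is a monoid on `D_i`" — through which "`C_i` is a Frobenioid" and C38-L01 are
theorems), `hR_i` ([EtTh] Rmk. 3.6.3, F-0581) and the criterion C38-L05 at THE perfections `h5_i`.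
[cite: MochizukiEtTh2009, Cor 3.8 p.81] -/
theorem cor38_ii_canonical (h34 : FrdI.Thm34ii.{w, v, max v w, u, max u w})
    (h411 : FrdI.Cor411ii.{w, v, max v w, u, max u w})
    (hBmon₁ : IsMonoidOn C₁.ratFnFunctor) (hBmon₂ : IsMonoidOn C₂.ratFnFunctor)
    (hR₁ : C₁.Remark363) (hR₂ : C₂.Remark363)
    (h5₁ : C₁.BsFldPreStepLimitCriterion
      (PreFrobenioidData.perfection (C₁.isFrobenioid_treeCatVocab_of_isMonoidOn hBmon₁)))
    (h5₂ : C₂.BsFldPreStepLimitCriterion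
      (PreFrobenioidData.perfection (C₂.isFrobenioid_treeCatVocab_of_isMonoidOn hBmon₂))) :
    Literature.AnabelianGeometry.EtaleTheta.Cor38_ii
      (fun E _ Φ => ∀ (A : E) (α : Aut (Over.forget A)),
        (∀ (B : Over A) (x : Φ.obj (op B.left)),
          Literature.AlgebraicGeometry.Frobenioids.pull Φ (α.hom.app B) x = x) → α = 1) h :=
  h.cor38_ii_of_criterion_tree h34 h411 _ _ (h.standardIsotropicNotGroupLike_treeCatVocab hBmon₁ hBmon₂) hR₁ hR₂
    h5₁ h5₂

end Cor38Hyp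

end Literature.AnabelianGeometry.EtaleTheta
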